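import Summits.QuantumFields.YangMills.Theorems.BalabanLadderNTReferenceTransfer
import Literature.MathematicalPhysics.QuantumLattice.LatticeGaugeDLRBoxKernels
import Literature.MathematicalPhysics.QuantumFieldTheory.SpeciesTimeReflection
import HarnessLib

/-!
# Crux `NT` (stmt-QuantumFields-19353) / `UVSeamRec.stub_floorsEngine` (stmt-QuantumFields-20043):
# the Markov mirror factorisation (card `markov-mirror-dirichlet-response`, first lemma X2)

Helper file of the fleet lead prover of crux `UVSeamRec` (unit `ym-spine-20043-p1`, g6), on the floors-engine
lineage (crux idea `Cruxes/NT/Ideas/markov-mirror-dirichlet-response.md`, seat `ym-cruxidea-19353-1` g4; owner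
READING R49 (5): «X2 — PROVE from p145262 — is a fine idle-prover helper target»).  The card's lever is the
NELSON–MARKOV / DLR factorisation of Wilson's torus measure across two SEPARATED cubes: for bounded continuous
cylinder observables `F`, `G'` carried by cubes `Q₁`, `Q₂` of `ℤ⁴` whose site ranges are separated by at least one
lattice layer in some coordinate direction (so that no plaquette meets links of both),
`Cov_T(F∘lift, G'∘lift) = Cov_T(kerE_{Q₁}(F)∘lift, kerE_{Q₂}(G')∘lift)` — the conditional covariance given the
joint exterior vanishes IDENTICALLY, and the whole two-point signal is the covariance of two ONE-POINT boundary
responses.  For the mirror pair of clause (i) of `LowerBounds` (`F∘Θ₀` versus `F`, `Θ₀ = cfgReflect` the site time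
reflection, `Q₋ = Θ₀Q₊`) this gives `Cov_T(F̃∘ϑ, F̃) = Cov_T(m∘ϑ, m)` with `m := kerE_{Q₊}(F)∘lift` and `ϑ` the torus
site reflection `GaugeConfig.negReflect` — the squared Osterwalder–Schrader seminorm of ONE cube's boundary response.

The proofs use only the tree's one-region torus DLR step in window form
(`StubLower.integral_torusLift_eq_integral_kernel`, from `wilsonExpectation_toTorusObservable_eq`), properness of
the lattice Yang–Mills kernel (`integral_ymSpecification_cyl_mul`: an exterior cylinder factor pulls out),
quasilocality (`dependsOn_integral_ymSpecification`: the kernel mean reads the observable's links and the collar),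
the Feller property (`Reference.continuous_kerE`) and the `ϑ`-invariance of Wilson's torus measure
(`integral_comp_negReflect_eq`, `torusLift_negReflect`).  No conditional expectation is formed: the exterior
factor is pulled through the kernel, which is how Georgii 2011 Rem. 1.24 reads for a finite-range specification.

* `collar_window`, `kerE_supp_window` — the links read by a cube kernel sit in the window `[c − 1, c + b]`;
* `isCylinder_kerE` — quasilocality of `η ↦ kerE_{(c,b)}^η F`;
* `continuous_cfgReflect`, `isCylinder_comp_cfgReflect`, `reflectEdge_fst_zero(_le)`, `reflectEdge_fst_of_ne` —
  bookkeeping for the `ℤ⁴` time reflection `Θ₀`;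
* `integral_mul_lift_eq_integral_mul_kerE` — **one-sided DLR step with an exterior spectator**:
  `∫ (H·F)∘lift dμ_T = ∫ (H · kerE_Q F)∘lift dμ_T` for a cylinder spectator `H` off the interior links of `Q`;
* `integral_lift_mul_lift_eq_integral_kerE_mul_kerE` — **X2**: `E_T[F̃ G̃'] = E_T[m_F m_G]` for two separated cubes,
  and `torusCov_lift_eq_torusCov_kerE` (the covariance form, odd tori, `torusE` vocabulary);
* the MIRROR FORM `Cov_T(F̃∘ϑ, F̃) = Cov_T(m∘ϑ, m)` for a cube at times `≥ 1` is in the sequel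
  `…NTMarkovMirrorReflect.lean` (`integral_reflect_lift_mul_lift_eq`, `torusCov_reflect_lift_eq_torusCov_reflect_kerE`).

Refs: E. Nelson, J. Funct. Anal. 12 (1973) 97 (Markov property); H.-O. Georgii, *Gibbs Measures and Phase
Transitions* (2011), Rem. 1.24, (2.11), Thm. 4.17; S. Friedli, Y. Velenik (2017) §6.3; K. Osterwalder, E. Seiler,
Ann. Phys. 110 (1978) 440, §2; E. Seiler, LNP 159 (1982) Ch. 2.
-/

set_option autoImplicit false

noncomputable section

open MeasureTheory Filter Topology
open Literature.MathematicalPhysics.QuantumFieldTheory Literature.MathematicalPhysics.QuantumLattice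
open Literature.Probability.LatticeModels
open Summit.QuantumFields.YangMills.Cruxes.OSLegsFromFemtoAndGap.DlrCollarTransfer
open Summit.QuantumFields.YangMills.Cruxes.OSLegsFromFemtoAndGap.DlrCollarTransfer.StubLower
  (isCylinder_mul mem_cubeSites_iff)
open Summit.QuantumFields.YangMills.Theorems.OSLegsFromFemtoAndGap.StubLower
  (integral_torusLift_eq_integral_kernel exists_near_of_mem_plaquetteEdges_touching)
open Summit.QuantumFields.YangMills.Cruxes.NT.Reference (continuous_kerE continuous_kerE_torusLift abs_mul_le_of_abs_le)
open Summit.QuantumFields.YangMills.Cruxes.NT.BoundaryLaw (abs_kerE_le)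
open Summit.QuantumFields.YangMills.Cruxes.OSLegsAtWeakCouplingC.InheritedAmplitudeGates.StubInherit
  (integral_lift_eq_integral_kerE_cube)

namespace Summit.QuantumFields.YangMills.Cruxes.NT.MarkovMirror

/-! ## §1 Geometry: the collar window of a cube kernel; the `ℤ⁴` time reflection on cylinders -/

section Geometry

/-- **Collar window.**  A link of a plaquette touching the interior links of the cube `(c, b)` is based in the
window `[c − 1, c + b]` (coordinatewise): the Wilson interaction has range one. [folklore] -/
theorem collar_window {c : Fin 4 → ℤ} {b : ℕ} {e : Literature.MathematicalPhysics.QuantumLattice.ZdEdge 4}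
    (he : e ∈ (plaquettesTouching (cubeEdges c b)).biUnion plaquetteEdges) (j : Fin 4) :
    c j - 1 ≤ e.1 j ∧ e.1 j ≤ c j + b := by
  obtain ⟨e', he', hnear⟩ := exists_near_of_mem_plaquetteEdges_touching he
  have h := (mem_cubeSites_iff _ _ _).1 (fst_mem_cubeSites_of_mem_cubeEdges he') j
  have h' := hnear j
  constructor <;> linarith [h.1, h.2, h'.1, h'.2]

/-- **Support window of a cube-kernel mean.**  If the observable's links are based in `[c, c + b]`, the links read
by its `(c, b)`-kernel mean (its own links and the collar) are based in `[c − 1, c + b]`. [folklore] -/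
theorem kerE_supp_window {c : Fin 4 → ℤ} {b : ℕ}
    {S : Finset (Literature.MathematicalPhysics.QuantumLattice.ZdEdge 4)}
    (hS : ∀ e ∈ S, ∀ j, c j ≤ e.1 j ∧ e.1 j ≤ c j + b)
    {e : Literature.MathematicalPhysics.QuantumLattice.ZdEdge 4}
    (he : e ∈ S ∪ (plaquettesTouching (cubeEdges c b)).biUnion plaquetteEdges) (j : Fin 4) :
    c j - 1 ≤ e.1 j ∧ e.1 j ≤ c j + b := by
  rcases Finset.mem_union.1 he with h | h
  · have := hS e h j
    constructor <;> linarith [this.1, this.2]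
  · exact collar_window h j

/-- Interior links of the cube `(c, b)` are based in `[c, c + b − 1]`. [folklore] -/
theorem cubeEdges_fst_window {c : Fin 4 → ℤ} {b : ℕ} {e : Literature.MathematicalPhysics.QuantumLattice.ZdEdge 4}
    (he : e ∈ cubeEdges c b) (j : Fin 4) : c j ≤ e.1 j ∧ e.1 j + 1 ≤ c j + b := by
  have h := (mem_cubeSites_iff _ _ _).1 (fst_mem_cubeSites_of_mem_cubeEdges he) j
  constructor <;> linarith [h.1, h.2]

variable {G : Type} [Group G]

/-- The base point of a reflected link: unchanged spatial coordinates. [folklore] -/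
theorem reflectEdge_fst_of_ne (e : Literature.MathematicalPhysics.QuantumLattice.ZdEdge 4) {j : Fin 4} (hj : j ≠ 0) :
    (reflectEdge e).1 j = e.1 j := by
  unfold reflectEdge
  split_ifs with h
  · simp [siteReflect_apply_of_ne _ hj, hj]
  · simp [siteReflect_apply_of_ne _ hj]

/-- The base point of a reflected link: the time coordinate is `−t − 1` (temporal link) or `−t` (spatial link),
so it lies in `[−t − 1, −t]`. [folklore] -/
theorem reflectEdge_fst_zero_le (e : Literature.MathematicalPhysics.QuantumLattice.ZdEdge 4) :
    -(e.1 0) - 1 ≤ (reflectEdge e).1 0 ∧ (reflectEdge e).1 0 ≤ -(e.1 0) := by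
  unfold reflectEdge
  split_ifs with h
  · simp only [Pi.sub_apply, siteReflect_apply_zero, Pi.single_eq_same]
    constructor <;> linarith
  · simp only [siteReflect_apply_zero]
    constructor <;> linarith

/-- The `ℤ⁴` time reflection `Θ₀ = cfgReflect` of gauge fields is continuous (coordinate permutation and
inversion). [folklore] -/
theorem continuous_cfgReflect [TopologicalSpace G] [ContinuousInv G] :
    Continuous (cfgReflect (G := G)) := by
  refine continuous_pi fun e => ?_
  by_cases h : e.2 = 0
  · simp only [cfgReflect, if_pos h]
    exact (continuous_apply _).inv
  · simp only [cfgReflect, if_neg h]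
    exact continuous_apply _

/-- A cylinder observable read on the reflected field is a cylinder observable on the reflected links. [folklore] -/
theorem isCylinder_comp_cfgReflect {α : Type*} {F : LGConfig 4 G → α}
    {S : Finset (Literature.MathematicalPhysics.QuantumLattice.ZdEdge 4)} (hF : IsCylinder F S) :
    IsCylinder (fun U => F (cfgReflect U)) (S.image reflectEdge) := by
  classical
  intro U V hUV
  refine hF fun e he => ?_
  have h := hUV (reflectEdge e) (Finset.mem_coe.2 (Finset.mem_image_of_mem _ (Finset.mem_coe.1 he)))
  change cfgReflect U e = cfgReflect V e
  simp only [cfgReflect, h]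

/-- Window of the reflected links: if the links of `S` are based in `[lo, hi]` in time and in `[c j, d j]` in the
spatial directions, the reflected links are based in `[−hi − 1, −lo]` in time and in the same spatial windows. [folklore] -/
theorem reflect_window {S : Finset (Literature.MathematicalPhysics.QuantumLattice.ZdEdge 4)} {lo hi : ℤ}
    (h0 : ∀ e ∈ S, lo ≤ e.1 0 ∧ e.1 0 ≤ hi)
    {e : Literature.MathematicalPhysics.QuantumLattice.ZdEdge 4} (he : e ∈ S.image reflectEdge) :
    -hi - 1 ≤ e.1 0 ∧ e.1 0 ≤ -lo ∧ ∀ j : Fin 4, j ≠ 0 → ∃ e' ∈ S, e.1 j = e'.1 j := by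
  classical
  obtain ⟨e', he', rfl⟩ := Finset.mem_image.1 he
  have h := h0 e' he'
  have hr := reflectEdge_fst_zero_le e'
  exact ⟨by linarith [hr.1, h.2], by linarith [hr.2, h.1], fun j hj => ⟨e', he', reflectEdge_fst_of_ne e' hj⟩⟩

end Geometry

/-! ## §2 The one-sided DLR step with an exterior spectator -/

section DLR

variable (G : Type) [Group G] [TopologicalSpace G] [IsTopologicalGroup G] [CompactSpace G]
  [MeasurableSpace G] [BorelSpace G] (r : LatticeRep G)

/-- **Quasilocality of cube-kernel means.**  The `(c, b)`-kernel mean of a cylinder observable with link support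
`S` is a cylinder observable of the exterior supported on `S` and the collar of the cube (tree
`dependsOn_integral_ymSpecification`). [folklore] -/
theorem isCylinder_kerE (β : ℝ) (c : Fin 4 → ℤ) (b : ℕ) {F : LGConfig 4 G → ℝ} (hF : Measurable F)
    {S : Finset (Literature.MathematicalPhysics.QuantumLattice.ZdEdge 4)} (hFS : IsCylinder F S) :
    IsCylinder (fun η => kerE G r β c b η F) (S ∪ (plaquettesTouching (cubeEdges c b)).biUnion plaquetteEdges) := by
  haveI := r.secondCountableTopology
  unfold kerE
  exact dependsOn_integral_ymSpecification r.ρ r.continuous β _ hF hFS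

/-- **One-sided DLR step with an exterior spectator.**  Let `F` be a bounded continuous cylinder observable whose
links are based in the window `[c, c + b]` of the cube `Q = (c, b)`, and `H` a bounded continuous cylinder
observable reading NO interior link of `Q`; assume the cube, the support of `F` and the support of `H` sit (with
margin) in one coordinate window of width `T`.  Then on the torus of side `T`
`∫ H(lift U) · F(lift U) dμ_T = ∫ H(lift U) · kerE_Q^{lift U}(F) dμ_T`:
the torus DLR step for the product `H · F` (`integral_torusLift_eq_integral_kernel`) followed by properness of the
kernel (`integral_ymSpecification_cyl_mul`: the exterior factor `H` pulls out).  With `H = 1` this is the one-cube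
DLR step; read with `H` ranging over exterior cylinders it says that `kerE_Q(F)∘lift` is a version of the conditional
expectation of `F∘lift` given the links off `Q`. [folklore] -/
theorem integral_mul_lift_eq_integral_mul_kerE (β : ℝ) (c : Fin 4 → ℤ) (b T : ℕ) [NeZero T] (lo : Fin 4 → ℤ)
    (hc : ∀ j, lo j + 1 ≤ c j ∧ c j + (b : ℤ) + 2 ≤ lo j + T)
    {F H : LGConfig 4 G → ℝ} (hFc : Continuous F) (hHc : Continuous H) {MF MH : ℝ}
    (hMF : ∀ U, |F U| ≤ MF) (hMH : ∀ U, |H U| ≤ MH)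
    {SF SH : Finset (Literature.MathematicalPhysics.QuantumLattice.ZdEdge 4)}
    (hFS : IsCylinder F SF) (hHS : IsCylinder H SH)
    (hSF : ∀ e ∈ SF, ∀ j, c j ≤ e.1 j ∧ e.1 j ≤ c j + b)
    (hSHoff : ∀ e ∈ SH, e ∉ cubeEdges c b)
    (hSHwin : ∀ e ∈ SH, ∀ j, lo j + 1 ≤ e.1 j ∧ e.1 j + 2 ≤ lo j + T) :
    ∫ U, H (torusLift T U) * F (torusLift T U) ∂(wilsonMeasure (d := 4) (L := T) r.ρ β) =
      ∫ U, H (torusLift T U) * kerE G r β c b (torusLift T U) F ∂(wilsonMeasure (d := 4) (L := T) r.ρ β) := by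
  haveI := r.secondCountableTopology
  have hHF : Continuous fun U => H U * F U := hHc.mul hFc
  have hHFb : ∀ U, |H U * F U| ≤ MH * MF := abs_mul_le_of_abs_le G hMH hMF
  have hwin : ∀ e ∈ cubeEdges c b ∪ (SH ∪ SF), ∀ j, lo j + 1 ≤ e.1 j ∧ e.1 j + 2 ≤ lo j + T := by
    intro e he j
    have hcj := hc j
    rcases Finset.mem_union.1 he with h1 | h2
    · have := cubeEdges_fst_window h1 j
      constructor <;> linarith [this.1, this.2]
    · rcases Finset.mem_union.1 h2 with hH | hF
      · exact hSHwin e hH j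
      · have := hSF e hF j
        constructor <;> linarith [this.1, this.2]
  have key := integral_torusLift_eq_integral_kernel r.ρ r.continuous β (cubeEdges c b) hHF hHFb
    (isCylinder_mul hHS hFS) T lo hwin
  rw [key]
  refine integral_congr_ae (ae_of_all _ fun U => ?_)
  show ∫ V, H V * F V ∂(ymSpecification (d := 4) r.ρ β (cubeEdges c b) (torusLift T U)) = _
  unfold kerE
  exact integral_ymSpecification_cyl_mul r.ρ r.continuous β _ hFc.measurable hHc.measurable hHS hSHoff _


/-- **Separated cubes do not read each other.**  If the site ranges of the cubes `(c₁, b)` and `(c₂, b)` are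
separated by at least one lattice layer in the coordinate direction `j` (`c₁ j + b + 1 ≤ c₂ j` or symmetrically),
then a link based in the kernel window `[c₂ − 1, c₂ + b]` of the second cube is not an interior link of the first
(no plaquette meets interior links of both cubes). [folklore] -/
theorem not_mem_cubeEdges_of_separated {c₁ c₂ : Fin 4 → ℤ} {b : ℕ} {j : Fin 4}
    (hsep : c₁ j + (b : ℤ) + 1 ≤ c₂ j ∨ c₂ j + (b : ℤ) + 1 ≤ c₁ j)
    {e : Literature.MathematicalPhysics.QuantumLattice.ZdEdge 4} (he : c₂ j - 1 ≤ e.1 j ∧ e.1 j ≤ c₂ j + b) :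
    e ∉ cubeEdges c₁ b := by
  intro h
  have := cubeEdges_fst_window h j
  rcases hsep with h1 | h1 <;> linarith [this.1, this.2, he.1, he.2]

/-! ## §3 X2 — the Markov factorisation for two separated cubes -/

/-- **X2 (card `markov-mirror-dirichlet-response`) — Markov factorisation across two separated cubes.**
Two cubes `Q₁ = (c₁, b)`, `Q₂ = (c₂, b)` of `ℤ⁴` inside one coordinate window of the torus of side `T` (margin 2
below, so that the collars fit), whose site ranges are separated by at least ONE lattice layer in some coordinate
direction; bounded continuous cylinder observables `F`, `G'` with links based in the windows `[c₁, c₁ + b]`,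
`[c₂, c₂ + b]`.  Then
`E_T[F∘lift · G'∘lift] = E_T[kerE_{Q₁}(F)∘lift · kerE_{Q₂}(G')∘lift]`:
pull `F` through `Q₁` with the exterior spectator `G'`, then `G'` through `Q₂` with the exterior spectator
`kerE_{Q₁}(F)` (a cylinder on `supp F ∪ collar(Q₁)`, which misses the interior links of `Q₂` by the separation).
Together with the one-cube DLR steps `E_T[F∘lift] = E_T[kerE_{Q₁}(F)∘lift]` this says that the conditional
covariance of `F∘lift`, `G'∘lift` given the joint exterior VANISHES IDENTICALLY (Georgii 2011 Rem. 1.24 for the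
finite-range Wilson specification; the card cites p145262 `condExp_prod_cubes_wilsonMeasure` for the conditional-
expectation phrasing). [folklore] -/
theorem integral_lift_mul_lift_eq_integral_kerE_mul_kerE (β : ℝ) (c₁ c₂ : Fin 4 → ℤ) (b T : ℕ) [NeZero T]
    (lo : Fin 4 → ℤ)
    (h₁ : ∀ j, lo j + 2 ≤ c₁ j ∧ c₁ j + (b : ℤ) + 2 ≤ lo j + T)
    (h₂ : ∀ j, lo j + 2 ≤ c₂ j ∧ c₂ j + (b : ℤ) + 2 ≤ lo j + T)
    (hsep : ∃ j : Fin 4, c₁ j + (b : ℤ) + 1 ≤ c₂ j ∨ c₂ j + (b : ℤ) + 1 ≤ c₁ j)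
    {F G' : LGConfig 4 G → ℝ} (hFc : Continuous F) (hGc : Continuous G') {MF MG : ℝ}
    (hMF : ∀ U, |F U| ≤ MF) (hMG : ∀ U, |G' U| ≤ MG)
    {SF SG : Finset (Literature.MathematicalPhysics.QuantumLattice.ZdEdge 4)}
    (hFS : IsCylinder F SF) (hGS : IsCylinder G' SG)
    (hSF : ∀ e ∈ SF, ∀ j, c₁ j ≤ e.1 j ∧ e.1 j ≤ c₁ j + b)
    (hSG : ∀ e ∈ SG, ∀ j, c₂ j ≤ e.1 j ∧ e.1 j ≤ c₂ j + b) :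
    ∫ U, F (torusLift T U) * G' (torusLift T U) ∂(wilsonMeasure (d := 4) (L := T) r.ρ β) =
      ∫ U, kerE G r β c₁ b (torusLift T U) F * kerE G r β c₂ b (torusLift T U) G'
        ∂(wilsonMeasure (d := 4) (L := T) r.ρ β) := by
  haveI := r.secondCountableTopology
  obtain ⟨j₀, hj₀⟩ := hsep
  -- step A: pull `F` through `Q₁`; the spectator `G'` reads no interior link of `Q₁`
  have hA : ∫ U, G' (torusLift T U) * F (torusLift T U) ∂(wilsonMeasure (d := 4) (L := T) r.ρ β) =
      ∫ U, G' (torusLift T U) * kerE G r β c₁ b (torusLift T U) F ∂(wilsonMeasure (d := 4) (L := T) r.ρ β) :=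
    integral_mul_lift_eq_integral_mul_kerE G r β c₁ b T lo (fun j => ⟨by linarith [(h₁ j).1], (h₁ j).2⟩)
      hFc hGc hMF hMG hFS hGS hSF
      (fun e he => not_mem_cubeEdges_of_separated hj₀ ⟨by linarith [(hSG e he j₀).1], (hSG e he j₀).2⟩)
      (fun e he j => ⟨by linarith [(hSG e he j).1, (h₂ j).1], by linarith [(hSG e he j).2, (h₂ j).2]⟩)
  -- step B: pull `G'` through `Q₂`; the spectator `kerE_{Q₁}(F)` reads no interior link of `Q₂`
  have hkc : Continuous fun η => kerE G r β c₁ b η F := continuous_kerE G r β c₁ b hFc hMF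
  have hkb : ∀ η, |kerE G r β c₁ b η F| ≤ MF := fun η => abs_kerE_le G r β c₁ b η hMF
  have hkS := isCylinder_kerE G r β c₁ b hFc.measurable hFS
  have hB : ∫ U, kerE G r β c₁ b (torusLift T U) F * G' (torusLift T U) ∂(wilsonMeasure (d := 4) (L := T) r.ρ β) =
      ∫ U, kerE G r β c₁ b (torusLift T U) F * kerE G r β c₂ b (torusLift T U) G'
        ∂(wilsonMeasure (d := 4) (L := T) r.ρ β) :=
    integral_mul_lift_eq_integral_mul_kerE G r β c₂ b T lo (fun j => ⟨by linarith [(h₂ j).1], (h₂ j).2⟩)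
      hGc hkc hMG hkb hGS hkS hSG
      (fun e he => not_mem_cubeEdges_of_separated hj₀.symm (kerE_supp_window hSF he j₀))
      (fun e he j => by
        have := kerE_supp_window hSF he j
        constructor <;> linarith [this.1, this.2, (h₁ j).1, (h₁ j).2])
  calc ∫ U, F (torusLift T U) * G' (torusLift T U) ∂(wilsonMeasure (d := 4) (L := T) r.ρ β)
      = ∫ U, G' (torusLift T U) * F (torusLift T U) ∂(wilsonMeasure (d := 4) (L := T) r.ρ β) :=
        integral_congr_ae (ae_of_all _ fun U => mul_comm _ _)
    _ = _ := hA
    _ = ∫ U, kerE G r β c₁ b (torusLift T U) F * G' (torusLift T U) ∂(wilsonMeasure (d := 4) (L := T) r.ρ β) :=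
        integral_congr_ae (ae_of_all _ fun U => mul_comm _ _)
    _ = _ := hB

/-- **X2, covariance form on odd tori** (`torusE` vocabulary of the route Defs): for two separated cubes inside the
torus of side `2L+1` (coordinatewise `−L + 2 ≤ cᵢ`, `cᵢ + b + 2 ≤ L + 1`) and `F`, `G'` as above,
`torusCov_L(F, G') = torusCov_L(kerE_{Q₁}F, kerE_{Q₂}G')` — the torus covariance of the two observables equals
the torus covariance of their one-point boundary responses. [folklore] -/
theorem torusCov_lift_eq_torusCov_kerE (β : ℝ) (c₁ c₂ : Fin 4 → ℤ) (b L : ℕ)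
    (h₁ : ∀ j, -(L : ℤ) + 2 ≤ c₁ j ∧ c₁ j + (b : ℤ) + 2 ≤ (L : ℤ) + 1)
    (h₂ : ∀ j, -(L : ℤ) + 2 ≤ c₂ j ∧ c₂ j + (b : ℤ) + 2 ≤ (L : ℤ) + 1)
    (hsep : ∃ j : Fin 4, c₁ j + (b : ℤ) + 1 ≤ c₂ j ∨ c₂ j + (b : ℤ) + 1 ≤ c₁ j)
    {F G' : LGConfig 4 G → ℝ} (hFc : Continuous F) (hGc : Continuous G') {MF MG : ℝ}
    (hMF : ∀ U, |F U| ≤ MF) (hMG : ∀ U, |G' U| ≤ MG)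
    {SF SG : Finset (Literature.MathematicalPhysics.QuantumLattice.ZdEdge 4)}
    (hFS : IsCylinder F SF) (hGS : IsCylinder G' SG)
    (hSF : ∀ e ∈ SF, ∀ j, c₁ j ≤ e.1 j ∧ e.1 j ≤ c₁ j + b)
    (hSG : ∀ e ∈ SG, ∀ j, c₂ j ≤ e.1 j ∧ e.1 j ≤ c₂ j + b) :
    torusE G r β L (fun U => F U * G' U) - torusE G r β L F * torusE G r β L G' =
      torusE G r β L (fun η => kerE G r β c₁ b η F * kerE G r β c₂ b η G') -
        torusE G r β L (fun η => kerE G r β c₁ b η F) * torusE G r β L (fun η => kerE G r β c₂ b η G') := by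
  have hT : b + 3 ≤ 2 * L + 1 := by have := h₁ 0; omega
  have hw : ∀ (c : Fin 4 → ℤ), (∀ j, -(L : ℤ) + 2 ≤ c j ∧ c j + (b : ℤ) + 2 ≤ (L : ℤ) + 1) →
      ∀ j, (fun _ : Fin 4 => -(L : ℤ)) j + 2 ≤ c j ∧ c j + (b : ℤ) + 2 ≤ (fun _ : Fin 4 => -(L : ℤ)) j + (2 * L + 1 : ℕ) :=
    fun c hc j => ⟨(hc j).1, by push_cast; linarith [(hc j).2]⟩
  unfold torusE
  rw [integral_lift_mul_lift_eq_integral_kerE_mul_kerE G r β c₁ c₂ b (2 * L + 1) (fun _ => -(L : ℤ)) (hw c₁ h₁)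
      (hw c₂ h₂) hsep hFc hGc hMF hMG hFS hGS hSF hSG,
    integral_lift_eq_integral_kerE_cube G r β c₁ b (2 * L + 1) hT hFc hMF hFS hSF,
    integral_lift_eq_integral_kerE_cube G r β c₂ b (2 * L + 1) hT hGc hMG hGS hSG]

end DLR

end Summit.QuantumFields.YangMills.Cruxes.NT.MarkovMirror

end
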